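import Summits.ResolutionOfSingularities.ResolutionOfSingularities.Theorems.ValuativeLuAlphaPTorsorSequenceModel
import Literature.AlgebraicGeometry.Resolution.IntegralClosureEssFiniteType
import Literature.AlgebraicGeometry.Resolution.RankOneReductionProofs
import Mathlib.RingTheory.Localization.Submodule
import Mathlib.FieldTheory.IntermediateField.Adjoin.Basic
import HarnessLib

/-!
# Crux `Steer` (stmt-ResolutionOfSingularities-16345), chain W4.1, R1-odd phase machine: **P0 `MaxGenExists`**
# (maximal generators of the torsor exist over every member of the point sequence; Theses-free body)

OURS (campaign `res-hironaka`, rung L, slot W4.1, chain W4.1; replaces the role of no printed item; NOT a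
statement of the manuscript under review; AI review is weaker than expert review). This file PROVES
the dischargeable piece **P0 `MaxGenExists`** of the planner's typed sub-plan
`L/w41/Sketch-R1-phases.lean` v3 §3.1 (res-L0-w41-plan-1 g6; CHAIN W4.1 v5.2 §B «P0 (any)», v5.3 arrival
table) with the vocabulary `GenAt` / `IsMaxGenAt` UNFOLDED verbatim and with ONLY the binders the proof
uses (the first three conjuncts `A₀.FG`, `t ^ p ∈ A₀`, `IsFractionRing (A₀[t]) K` of the sketch's
`CoreDatum`, and `p ≠ 0`), so that the by-name leaf for the sketch's `MaxGenExists` is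

  `fun p hp n _ k K _ _ _ _ _ O A₀ h₀ t hC R hR0 hstep M => by
     obtain ⟨hfg, htp, hfr, -⟩ := hC
     exact MaxGenExists.exists_isMaxGenAt_of_sequence k K O A₀ h₀ hfg hp.ne_zero htp hfr R hR0 hstep M`.

## Statement proved (`MaxGenExists.exists_isMaxGenAt_of_sequence`)

For fields `k ⊆ K`, a valuation ring `O` of `K`, a finitely generated `k`-subalgebra `A₀ ⊆ O`, `p ≠ 0`,
`t ∈ K` with `t ^ p ∈ A₀` and `Frac (A₀[t]) = K`, and a sequence `R : ℕ → Subring K` of quadratic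
transforms along `O` with `R 0 = (A₀)_{𝔪_O ∩ A₀}`: for every `M` there is a MAXIMAL GENERATOR `s'` of
the torsor of `t` over `S := R M`, i.e. `s' ^ p ∈ S`, `t ∈ S[s']`, and every `s''` with `s'' ^ p ∈ S`
and `s' ∈ S[s'']` already lies in `S[s']`.

## Proof

(1) PURE ALGEBRA (`MaxGenExists.exists_isMaxGenAt`): for a subring `S` of a field `K` which is
Noetherian and whose integral closure `N` in `K` is a finite `S`-module, and `t ^ p ∈ S` (`p ≠ 0`): the
orders `S[s'']` with `s'' ^ p ∈ S` consist of elements integral over `S` (`X ^ p − s'' ^ p`), so they are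
`S`-submodules of the Noetherian `S`-module `N`; among those containing `t` (`t` itself is a generator)
there is a maximal one `S[s']` (`set_has_maximal_iff_noetherian`), and maximality of the submodule is
exactly the printed maximality of the generator.
(2) THE MEMBERS OF THE SEQUENCE QUALIFY: `R M = (A₁)_{𝔪_O ∩ A₁}` inside `K` for a finitely generated
model `A₀ ≤ A₁ ⊆ O` (`exists_model_of_sequence_member`), so `R M` is a localisation of the Noetherian
ring `A₁` (`isLocalization_locAtCentre`), hence Noetherian; `K = Frac(A₁)(t)` is a finite extension of
`Frac A₁` (`t ^ p ∈ A₁`), so the integral closure of `A₁` in `K` is a finite `A₁`-module by E. NOETHER's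
finiteness theorem (tree named fact `NoetherFiniteIntegralClosure_holds`, Liu 2002 Prop. 4.1.27), and
finiteness passes to the localisation `R M` (tree `module_finite_integralClosure_of_isLocalization`,
Stacks 0307). [cite: Liu2002, Prop. 4.1.27, p. 122] [cite: StacksProject, Tag 0307]
[cite: Matsumura1987, §32] [folklore]
-/

noncomputable section

-- `Summit.<S>.<S>.…` duplicates the summit name by design (single-problem summit).
set_option linter.dupNamespace false

open Polynomial IsLocalRing

namespace Summit.ResolutionOfSingularities.ResolutionOfSingularities.Theorems.SwitchingDichotomy

open Literature.AlgebraicGeometry.Resolution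
open Summit.ResolutionOfSingularities.ResolutionOfSingularities.Theorems.PfaffLine
  (exists_model_of_sequence_member)

namespace MaxGenExists

/-! ## (1) Pure algebra: maximal simple orders over a Noetherian subring with finite normalisation -/

section Algebra

variable {K : Type} [Field K]

/-- An element `s` of `K` with `s ^ p ∈ S` (`p ≠ 0`) is integral over the subring `S`: it is a root of
the monic `X ^ p − s ^ p`. [folklore] -/
theorem isIntegral_of_pow_mem (S : Subring K) {p : ℕ} (hp : p ≠ 0) {s : K} (hs : s ^ p ∈ S) :
    IsIntegral S s := by
  refine ⟨X ^ p - C ⟨s ^ p, hs⟩, monic_X_pow_sub_C _ hp, ?_⟩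
  rw [eval₂_sub, eval₂_X_pow, eval₂_C]
  exact sub_self _

/-- The simple order `S[s]` of an element with `s ^ p ∈ S` (`p ≠ 0`) consists of elements integral over
`S`. [folklore] -/
theorem isIntegral_of_mem_closure_insert (S : Subring K) {p : ℕ} (hp : p ≠ 0) {s : K} (hs : s ^ p ∈ S)
    {x : K} (hx : x ∈ Subring.closure (insert s (S : Set K))) : IsIntegral S x := by
  have hle : Subring.closure (insert s (S : Set K)) ≤ (integralClosure S K).toSubring := by
    refine Subring.closure_le.mpr (Set.insert_subset ?_ fun y hy => ?_)
    · exact isIntegral_of_pow_mem S hp hs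
    · exact isIntegral_algebraMap (R := S) (A := K) (x := ⟨y, hy⟩)
  exact hle hx

/-- **Maximal generators exist** over a Noetherian subring `S ⊆ K` whose integral closure in `K` is a
finite `S`-module: for `t ^ p ∈ S` (`p ≠ 0`) there is `s'` with `s' ^ p ∈ S`, `t ∈ S[s']`, and such that
every `s''` with `s'' ^ p ∈ S` and `s' ∈ S[s'']` lies in `S[s']` (the orders `S[s'']` are submodules of
the Noetherian `S`-module `integralClosure S K`; take a maximal one containing `t`).
[cite: Matsumura1987, §32] [folklore] -/
theorem exists_isMaxGenAt (S : Subring K) (hN : IsNoetherianRing S)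
    (hfin : Module.Finite S (integralClosure S K)) {p : ℕ} (hp : p ≠ 0) {t : K} (ht : t ^ p ∈ S) :
    ∃ s' : K, (s' ^ p ∈ S ∧ t ∈ Subring.closure (insert s' (S : Set K))) ∧
      ∀ s'' : K, s'' ^ p ∈ S → s' ∈ Subring.closure (insert s'' (S : Set K)) →
        s'' ∈ Subring.closure (insert s' (S : Set K)) := by
  classical
  haveI := hN
  haveI := hfin
  set N : Subalgebra S K := integralClosure S K with hNdef
  haveI : IsNoetherian S N := isNoetherian_of_isNoetherianRing_of_finite S N
  -- the order `S[s]` as an `S`-submodule of `K`, and its trace on `N`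
  let T : K → Submodule S K := fun s =>
    { carrier := (Subring.closure (insert s (S : Set K)) : Set K)
      add_mem' := fun {x y} hx hy => Subring.add_mem _ hx hy
      zero_mem' := Subring.zero_mem _
      smul_mem' := fun c {x} hx => by
        change (c : K) * x ∈ Subring.closure (insert s (S : Set K))
        exact Subring.mul_mem _ (Subring.subset_closure (Set.mem_insert_of_mem _ c.2)) hx }
  have hT : ∀ s x, x ∈ T s ↔ x ∈ Subring.closure (insert s (S : Set K)) := fun _ _ => Iff.rfl
  let Φ : K → Submodule S N := fun s => (T s).comap (N.val.toLinearMap)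
  have hΦ : ∀ s (x : N), x ∈ Φ s ↔ (x : K) ∈ Subring.closure (insert s (S : Set K)) :=
    fun s x => by rw [Submodule.mem_comap]; exact hT s _
  -- the generators of the torsor of `t` over `S`
  let G : Set K := {s | s ^ p ∈ S ∧ t ∈ Subring.closure (insert s (S : Set K))}
  have htG : t ∈ G := ⟨ht, Subring.subset_closure (Set.mem_insert _ _)⟩
  obtain ⟨Q, ⟨s', hs'G, rfl⟩, hmax⟩ :=
    set_has_maximal_iff_noetherian.mpr ‹IsNoetherian S N› (Φ '' G) ⟨Φ t, t, htG, rfl⟩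
  refine ⟨s', hs'G, fun s'' hs''p hs's'' => ?_⟩
  have hle : Subring.closure (insert s' (S : Set K)) ≤ Subring.closure (insert s'' (S : Set K)) :=
    Subring.closure_le.mpr (Set.insert_subset hs's'' fun x hx =>
      Subring.subset_closure (Set.mem_insert_of_mem _ hx))
  have hs''G : s'' ∈ G := ⟨hs''p, hle hs'G.2⟩
  have hΦle : Φ s' ≤ Φ s'' := fun x hx => (hΦ s'' x).mpr (hle ((hΦ s' x).mp hx))
  have heq : Φ s' = Φ s'' := by
    by_contra hne
    exact hmax (Φ s'') ⟨s'', hs''G, rfl⟩ (lt_of_le_of_ne hΦle hne)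
  have hs''N : s'' ∈ N := show IsIntegral S s'' from isIntegral_of_pow_mem S hp hs''p
  have hmem : (⟨s'', hs''N⟩ : N) ∈ Φ s'' := (hΦ s'' _).mpr (Subring.subset_closure (Set.mem_insert _ _))
  rw [← heq] at hmem
  exact (hΦ s' _).mp hmem

end Algebra

/-! ## (2) The members of the point sequence: Noetherian, with finite integral closure in `K` -/

section Model

variable {k K : Type} [Field k] [Field K] [Algebra k K]

/-- **E. Noether for a finitely generated model**: for a finitely generated `k`-subalgebra `A₁` of `K` and
`t ∈ K` with `t ^ p ∈ A₁` (`p ≠ 0`) and `Frac (A₁[t]) = K`, the integral closure of `A₁` in `K` is a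
finite `A₁`-module (`K = Frac(A₁)(t)` is a finite extension of `Frac A₁`; tree named fact
`NoetherFiniteIntegralClosure_holds`). [cite: Liu2002, Prop. 4.1.27, p. 122] -/
theorem module_finite_integralClosure_model (A₁ : Subalgebra k K) (hfg : A₁.FG) {p : ℕ} (hp : p ≠ 0)
    {t : K} (htp : t ^ p ∈ A₁)
    (hfr : IsFractionRing (Algebra.adjoin k (insert t (A₁ : Set K))) K) :
    Module.Finite A₁ (integralClosure A₁ K) := by
  classical
  haveI : Algebra.FiniteType k A₁ := (Subalgebra.fg_iff_finiteType A₁).mp hfg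
  -- the fraction field of `A₁`, mapped into `K`
  let K' := FractionRing A₁
  have hinj : Function.Injective (algebraMap A₁ K) := Subtype.val_injective
  haveI : FaithfulSMul A₁ K := (faithfulSMul_iff_algebraMap_injective A₁ K).mpr hinj
  letI : Algebra K' K := FractionRing.liftAlgebra A₁ K
  have hT3 := FractionRing.isScalarTower_liftAlgebra (R := A₁) (K := K)
  let κ := algebraMap A₁ K'
  have hκ : ∀ y : A₁, algebraMap K' K (κ y) = (y : K) := fun y =>
    (IsScalarTower.algebraMap_apply A₁ K' K y).symm
  -- `t` is integral over `Frac A₁`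
  have hT : IsIntegral K' t := by
    refine ⟨X ^ p - C (κ ⟨t ^ p, htp⟩), monic_X_pow_sub_C _ hp, ?_⟩
    rw [eval₂_sub, eval₂_X_pow, eval₂_C, hκ]
    exact sub_self _
  -- `Frac A₁ ⟮t⟯ = K`
  have hTop : IntermediateField.adjoin K' {t} = ⊤ := by
    rw [eq_top_iff]
    intro z _
    -- the subalgebra `A₁[t] ⊆ Frac A₁ ⟮t⟯`
    have hA₁ : ∀ a ∈ A₁, a ∈ IntermediateField.adjoin K' {t} := fun a ha => by
      have h := IntermediateField.algebraMap_mem (IntermediateField.adjoin K' {t}) (κ ⟨a, ha⟩)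
      rwa [hκ] at h
    let G : Subalgebra k K :=
      { (IntermediateField.adjoin K' {t}).toSubring with
        algebraMap_mem' := fun c => hA₁ _ (A₁.algebraMap_mem c) }
    have hle : Algebra.adjoin k (insert t (A₁ : Set K)) ≤ G :=
      Algebra.adjoin_le (Set.insert_subset (IntermediateField.mem_adjoin_simple_self K' t) hA₁)
    haveI := hfr
    obtain ⟨a, b, -, rfl⟩ :=
      IsFractionRing.div_surjective (A := Algebra.adjoin k (insert t (A₁ : Set K))) z
    exact div_mem (hle a.2) (hle b.2)
  haveI : FiniteDimensional K' K := by
    have hfin : FiniteDimensional K' (IntermediateField.adjoin K' {t}) :=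
      IntermediateField.adjoin.finiteDimensional hT
    rw [hTop] at hfin
    exact LinearEquiv.finiteDimensional (IntermediateField.topEquiv (F := K') (E := K)).toLinearEquiv
  exact @NoetherFiniteIntegralClosure_holds k A₁ K' K _ _ _ _ _ _ _ _ _ _ _ _ hT3

/-- **The local ring of a finitely generated model at the centre qualifies**: for `A₁ ⊆ O` finitely
generated over `k`, `t ^ p ∈ A₁` (`p ≠ 0`), `Frac (A₁[t]) = K`, the subring `S := (A₁)_{𝔪_O ∩ A₁}` of `K`
is Noetherian and its integral closure in `K` is a finite `S`-module (localisation of E. Noether's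
finiteness, Stacks 0307). [cite: Liu2002, Prop. 4.1.27, p. 122] [cite: StacksProject, Tag 0307] -/
theorem isNoetherianRing_and_module_finite_locAtCentre (O : ValuationSubring K) (A₁ : Subalgebra k K)
    (h₁ : A₁.toSubring ≤ O.toSubring) (hfg : A₁.FG) {p : ℕ} (hp : p ≠ 0) {t : K} (htp : t ^ p ∈ A₁)
    (hfr : IsFractionRing (Algebra.adjoin k (insert t (A₁ : Set K))) K) :
    IsNoetherianRing (locAtCentre A₁.toSubring O) ∧
      Module.Finite (locAtCentre A₁.toSubring O) (integralClosure (locAtCentre A₁.toSubring O) K) := by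
  classical
  haveI : Algebra.FiniteType k A₁ := (Subalgebra.fg_iff_finiteType A₁).mp hfg
  have hNA : IsNoetherianRing A₁.toSubring := Algebra.FiniteType.isNoetherianRing k A₁
  haveI := isLocalization_locAtCentre (B := A₁.toSubring) (O := O) h₁
  have hfinA : Module.Finite A₁.toSubring (integralClosure A₁.toSubring K) :=
    module_finite_integralClosure_model A₁ hfg hp htp hfr
  refine ⟨IsLocalization.isNoetherianRing (subringCentre A₁.toSubring O h₁).primeCompl
    (locAtCentre A₁.toSubring O) hNA, ?_⟩
  exact module_finite_integralClosure_of_isLocalization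
    (A₀ := A₁.toSubring) (A := locAtCentre A₁.toSubring O) (K := K)
    (subringCentre A₁.toSubring O h₁).primeCompl hfinA

end Model

/-! ## (3) P0 `MaxGenExists` along the point sequence -/

/-- **P0 `MaxGenExists` (CHAIN W4.1, Sketch-R1-phases §3.1), with only the binders used**: for a finitely
generated `k`-subalgebra `A₀ ⊆ O` of `K`, `p ≠ 0`, `t ^ p ∈ A₀`, `Frac (A₀[t]) = K`, and a sequence
`R` of quadratic transforms along `O` with `R 0 = (A₀)_{𝔪_O ∩ A₀}`, over every member `R M` there is a
MAXIMAL GENERATOR `s'` of the torsor of `t`: `s' ^ p ∈ R M`, `t ∈ (R M)[s']`, and every `s''` with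
`s'' ^ p ∈ R M`, `s' ∈ (R M)[s'']` lies in `(R M)[s']` (the sketch's `IsMaxGenAt (R M) p t s'`, unfolded).
Proof: `R M = (A₁)_{𝔪_O ∩ A₁}` for a finitely generated model `A₀ ≤ A₁ ⊆ O`
(`exists_model_of_sequence_member`), which is Noetherian with finite integral closure in `K`
(`isNoetherianRing_and_module_finite_locAtCentre`), and `exists_isMaxGenAt`.
[cite: Liu2002, Prop. 4.1.27, p. 122] [cite: Matsumura1987, §32] [folklore] -/
theorem exists_isMaxGenAt_of_sequence (k K : Type) [Field k] [Field K] [Algebra k K]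
    (O : ValuationSubring K) (A₀ : Subalgebra k K) (h₀ : A₀.toSubring ≤ O.toSubring)
    (hfg : A₀.FG) {p : ℕ} (hp : p ≠ 0) {t : K} (htp : t ^ p ∈ A₀)
    (hfr : IsFractionRing (Algebra.adjoin k (insert t (A₀ : Set K))) K)
    (R : ℕ → Subring K) (hR0 : R 0 = locAtCentre A₀.toSubring O)
    (hstep : ∀ i, IsQuadraticTransformAlong O (R i) (R (i + 1))) (M : ℕ) :
    ∃ s' : K, (s' ^ p ∈ R M ∧ t ∈ Subring.closure (insert s' (R M : Set K))) ∧
      ∀ s'' : K, s'' ^ p ∈ R M → s' ∈ Subring.closure (insert s'' (R M : Set K)) →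
        s'' ∈ Subring.closure (insert s' (R M : Set K)) := by
  classical
  -- `R M` is the local ring at the centre of a finitely generated model `A₀ ≤ A₁ ⊆ O`
  have hO : O.comap (RingHom.id K) = O := by
    ext x
    rfl
  have hS : A₀.toSubring.comap (RingHom.id K) = A₀.toSubring := by
    ext x
    rfl
  obtain ⟨A₁, h₁, hle, hfg₁, -, hRM', -⟩ := exists_model_of_sequence_member k K K (RingHom.id K)
    O A₀ h₀ hfg (fun x _ => RingHom.mem_range.mpr ⟨x, rfl⟩) R (by rw [hO, hS]; exact hR0)
    (by rw [hO]; exact hstep) M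
  have hRM : locAtCentre A₁.toSubring O = R M := by
    rw [← hRM']
    ext x
    rfl
  -- the model `A₁` inherits the torsor datum
  have htp₁ : t ^ p ∈ A₁ := hle htp
  haveI := hfr
  have hfr₁ : IsFractionRing (Algebra.adjoin k (insert t (A₁ : Set K))) K :=
    isFractionRing_subalgebra_of_le (Algebra.adjoin k (insert t (A₀ : Set K)))
      (Algebra.adjoin k (insert t (A₁ : Set K))) (Algebra.adjoin_mono (Set.insert_subset_insert hle))
  obtain ⟨hN, hfin⟩ := isNoetherianRing_and_module_finite_locAtCentre O A₁ h₁ hfg₁ hp htp₁ hfr₁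
  have htS : t ^ p ∈ locAtCentre A₁.toSubring O := le_locAtCentre A₁.toSubring O htp₁
  have h := exists_isMaxGenAt (locAtCentre A₁.toSubring O) hN hfin hp htS
  rw [hRM] at h
  exact h

end MaxGenExists

end Summit.ResolutionOfSingularities.ResolutionOfSingularities.Theorems.SwitchingDichotomy

end
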